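/-
Origin: expansion seat `prover-pub-hodgecm-mc-binder-1-g15-0`, handover #R100 2026-08-20T19:10:37Z md5 108e8bbc65df (130 l.; NEW additive universe-free datum-generic (p = 2) leaf; imports #R97 + #R99 only; drops ⇒ {#R101, #R102}; NAME LIST: HodgeCM.Model.HeckeClassLiftRecords.conjInto_heckeLevel · HodgeCM.Model.HeckeClassLiftRecords.exists_heckeLevelModel · HodgeCM.Model.HeckeClassLiftRecords.heckeOpC_mem_hodge_F_one · HodgeCM.Model.HeckeClassLiftRecords.classLift_heckeOpC) (`HOME/mc/pub-hodgecm-mc-binder-1-g15/stage60/HodgeCM/Model/HeckeClassLiftRecords.lean`, md5 108e8bbc65df, 130 lines);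
landed by the second packager p2 gen 12 (p2-g12) in gate run 60 as `HodgeCM/Model/HeckeClassLiftRecords.lean` (verbatim).
-/
/-
Copyright (c) 2026 the pub-hodgecm formalisation cell (harness21).  New file, not vendored.
Origin: session prover-pub-hodgecm-mc-binder-1-g15-0 (unit pub-hodgecm-mc-binder-1-g15, BINDER PROVER gen 15 of lineage mc-binder-1;
content lane (J-Liu-Θ), scope memo `HOME/mc/pub-hodgecm-mc-binder-1-g14/JLIU-THETA-SCOPE.md` §9 (J2), HECKE-TOWER sub-leaf (T6c):
«(J2) UNCONDITIONAL for every compact ball quotient surface datum, over the records (ii-a), Arapura 15.4.6, R-HD, hI»), 2026-08-20.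
Intended final place: `HodgeCM/Model/HeckeClassLiftRecords.lean` (NEW additive leaf, universe-free, datum-generic (p = 2); imports ONLY this lane's
`HodgeCM.Model.HeckeClassLift` (#R97) and `HodgeCM.Model.HeckeAdmissible` (#R99); nothing imports it; drops with either).
-/
import Summits.HodgeConjecture.HodgeCM.Model.HeckeClassLift
import Summits.HodgeConjecture.HodgeCM.Model.HeckeAdmissible

set_option autoImplicit false

/-!
# (J2) over the cited records only: `lift (T_g ω) = [Γ':N_g]⁻¹ Σ_q (g γ̃_q)^* (lift ω)` for every compact ball quotient surface

`HeckeClassLift.classLift_heckeOpC` (#R97) proves the intertwining of the Hecke operator `T_g` on `F¹H¹(X)` with the sum of translates on the ball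
GIVEN (a) admissibility of `g` and (b) an algebraic model `(XN', DN', π, π_q)` of the Hecke level cover `N_g\𝔹² ⇉ Γ\𝔹²`.  Here both are DISCHARGED from the
cell's standing records, for ANY `D : UnitaryBallQuotientDatum 2 X` and ANY `g ∈ U(V)(F)`:

* (a) `HeckeAdmissible.isHeckeAdmissible hU D hg` (#R99; record (ii-a) `BallQuotientUniformisedDatum`);
* (b) `XN', DN'` := `HeckeAdmissible.exists_levelModel_heckeLevel` (record (ii-a) applied to the torsion-free congruence subgroup `N_g`, #R98);
  `π` := glue-1's `LevelCovering.exists_hom_map_unif_eq hA` (record `Arapura2012_Cor_15_4_6`, Hodge models from R-HD `hHD`);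
  `π_q` := `LevelCoveringTwist.exists_hom_map_unif_eq_mulVec hA` (#R93) for the isometry `(g γ̃_q)^{τ₁}`, which conjugates `N_g` into `Γ`
  (`conjInto_heckeLevel`: `N_g ⊴ Γ` and `g N_g g⁻¹ ⊆ Γ`, vendored `conj_mem_of_mem_heckeLevel`).

Results: `heckeOpC_mem_hodge_F_one` — **`T_g F¹H¹(X) ⊆ F¹H¹(X)`**; `classLift_heckeOpC` — **the (J2) identity** — both with hypotheses EXACTLY
`(hU : BallQuotientUniformisedDatum) (hA : Arapura2012_Cor_15_4_6) (hHD : exists_isReal_hodgeModel) (hI : hodgePQ_independent_of_hodgeModel)`, the datum `D`,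
a frame `𝔣`, `g ∈ U(V)(F)` and `ω ∈ F¹`.  At the model universe (`D := quotientDatumOf (ballDatumOf …) h₂`, #R90/#R91) this is `heckeOpModel` on `F¹` of
`U.CohC (P_Γ) 1` read through `classMapDatumOf` — a one-line specialisation for the junction leaf.  KIND: kernel theorems; records = the cell's standing
(ii-a), Arapura, R-HD, hI; nothing cited anew, nothing minted; 0 proof holes; expected `#print axioms` ⊆ {propext, Classical.choice, Quot.sound}.

References: G. Shimura (1971), §3.1, §7.2–7.3, §8.3 (8.3.2); D. Arapura (2012), §15.4 Cor. 15.4.6; Genestier–Ngô, Thm 4.5.2; C. Voisin (2002), §7.1.1, §7.3.2.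
-/

noncomputable section

open Matrix MulAction Function Set
open scoped TensorProduct
open CategoryTheory
open Literature.Geometry.ComplexHyperbolic
open Literature.Geometry.ComplexHyperbolic.BallModel (U21 Ball Jac)
open Literature.AlgebraicGeometry.HodgeTheory
open Literature.AlgebraicGeometry.Motives (SchemeOver ComplexPoints AlgPoints bettiCohomology IsSmoothProjective)
open Literature.NumberTheory.Transcendental (Arapura2012_Cor_15_4_6)
open Literature.NumberTheory.Automorphic.PicardCM (BallQuotientUniformisedDatum)

namespace HodgeCM.Model.HeckeClassLiftRecords

open Literature.AlgebraicGeometry.ShimuraVarieties UnitaryBallQuotientDatum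
open HodgeCM.Model.LevelCoveringTwist (ConjInto exists_hom_map_unif_eq_mulVec)
open HodgeCM.Model.HeckeAdmissible HodgeCM.Model.HeckeClassLift

variable {X XN' : SchemeOver ℂ} (D : UnitaryBallQuotientDatum 2 X) {g : GL (Fin 3) D.E}

/-- **`(g γ̃)^{τ₁}` conjugates `N_g` into `Γ`** (`N_g ⊴ Γ`, `g N_g g⁻¹ ⊆ Γ`): the hypothesis `ConjInto` of `LevelCoveringTwist` for a model `DN'` of the Hecke
level cover and a coset representative `g γ̃` of `Γ g Γ`. [cite: Shimura1973, §3.1] -/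
theorem conjInto_heckeLevel (h : D.IsHeckeAdmissible g) (DN' : UnitaryBallUniformisationDatum 2 XN')
    (hΓ' : DN'.Γ.map (Matrix.GeneralLinearGroup.map DN'.τ₁) = ((D.heckeLevel g).map D.Γ.subtype).map (Matrix.GeneralLinearGroup.map D.τ₁))
    (γ : ↥D.Γ) : ConjInto DN' D.toUnitaryBallUniformisationDatum (cosetRealPoint h γ : D.realPoints) := by
  intro δ hδ
  have hmem : Matrix.GeneralLinearGroup.map DN'.τ₁ δ ∈ ((D.heckeLevel g).map D.Γ.subtype).map (Matrix.GeneralLinearGroup.map D.τ₁) := by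
    rw [← hΓ']
    exact Subgroup.mem_map_of_mem _ hδ
  obtain ⟨_, ⟨n, hn, rfl⟩, hn'⟩ := Subgroup.mem_map.1 hmem
  rw [← hn']
  -- `(g γ) n (g γ)⁻¹ = g (γ n γ⁻¹) g⁻¹ ∈ Γ`
  have hconj : g * ((γ * n * γ⁻¹ : ↥D.Γ) : GL (Fin 3) D.E) * g⁻¹ ∈ D.Γ :=
    D.conj_mem_of_mem_heckeLevel g (Subgroup.Normal.conj_mem inferInstance n hn γ)
  refine Subgroup.mem_map.2 ⟨_, hconj, ?_⟩
  have hR : ((cosetRealPoint h γ : D.realPoints) : GL (Fin 3) ℂ) = Matrix.GeneralLinearGroup.map D.τ₁ (g * (γ : GL (Fin 3) D.E)) := rfl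
  rw [hR]
  simp only [map_mul, map_inv, Subgroup.coe_mul, InvMemClass.coe_inv, Subgroup.coe_subtype]
  group

/-- **The algebraic Hecke level cover with its two families of projections, from the records.** For `g ∈ U(V)(F)`: a smooth projective `XN'` with a ball
uniformization `DN'` by the same hermitian space and group `N_g` ((ii-a)), the projection `π : XN' ⟶ X` over the uniformizations and, for every `q ∈ Γ/N_g`, the
translate `π_q : XN' ⟶ X` over `v ↦ g γ̃_q v` (Arapura). [cite: GenestierNgo2020, Theorem 4.5.2] [cite: Arapura2012, §15.4 Cor. 15.4.6] -/
theorem exists_heckeLevelModel (hU : BallQuotientUniformisedDatum) (hA : Arapura2012_Cor_15_4_6) (hHD : exists_isReal_hodgeModel)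
    (hg : g ∈ unitaryGroup (conjRingHom D.E) D.H) :
    ∃ (XN' : SchemeOver ℂ) (DN' : UnitaryBallUniformisationDatum 2 XN') (_ : DN'.Hℂ = D.Hℂ)
      (_ : DN'.Γ.map (Matrix.GeneralLinearGroup.map DN'.τ₁) = ((D.heckeLevel g).map D.Γ.subtype).map (Matrix.GeneralLinearGroup.map D.τ₁))
      (π : XN' ⟶ X) (_ : ∀ v ∈ DN'.cone, AlgPoints.map π (DN'.unif v) = D.unif v)
      (πq : ↥D.Γ ⧸ D.heckeLevel g → (XN' ⟶ X)),
      ∀ q, ∀ v ∈ DN'.cone, v ∈ D.cone →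
        AlgPoints.map (πq q) (DN'.unif v) = D.unif (D.act (g * ((Quotient.out q : ↥D.Γ) : GL (Fin 3) D.E)) v) := by
  obtain ⟨XN', DN', hH', hΓ'⟩ := exists_levelModel_heckeLevel D hU hg
  have h : D.IsHeckeAdmissible g := isHeckeAdmissible D hU hg
  -- the projection
  have hle : DN'.Γ.map (Matrix.GeneralLinearGroup.map DN'.τ₁) ≤
      D.toUnitaryBallUniformisationDatum.Γ.map (Matrix.GeneralLinearGroup.map D.τ₁) := by
    rw [hΓ']
    exact Subgroup.map_mono (Subgroup.map_subtype_le _)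
  obtain ⟨π, hπ⟩ := LevelCovering.exists_hom_map_unif_eq (D₁ := DN') (D₂ := D.toUnitaryBallUniformisationDatum) hA hH' hle
    (BettiUniverse.realHodgeModel hHD DN'.isSmoothProjective) (BettiUniverse.realHodgeModel hHD D.isSmoothProjective)
  -- the translates
  have hq : ∀ q : ↥D.Γ ⧸ D.heckeLevel g, ∃ πq : XN' ⟶ X, ∀ v ∈ DN'.cone,
      AlgPoints.map πq (DN'.unif v) = D.unif ((((cosetRealPoint h (Quotient.out q) : D.realPoints) : GL (Fin 3) ℂ) : Matrix (Fin 3) (Fin 3) ℂ) *ᵥ v) :=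
    fun q ↦ exists_hom_map_unif_eq_mulVec (D₁ := DN') (D₂ := D.toUnitaryBallUniformisationDatum) hA hH' (cosetRealPoint h (Quotient.out q)).2
      (conjInto_heckeLevel D h DN' hΓ' (Quotient.out q))
      (BettiUniverse.realHodgeModel hHD DN'.isSmoothProjective) (BettiUniverse.realHodgeModel hHD D.isSmoothProjective)
  choose πq hπq using hq
  exact ⟨XN', DN', hH', hΓ', π, hπ, πq, fun q v hv _ ↦ hπq q v hv⟩

/-- **Hecke operators preserve `F¹H¹`, over the records**: for every compact ball quotient surface datum `D`, every `g ∈ U(V)(F)` and `ω ∈ F¹(ℂ ⊗ H¹(X(ℂ);ℚ))`,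
`T_g ω ∈ F¹`. [cite: Shimura1973, §8.3] [cite: VoisinHodgeI2002, §7.3.2] -/
theorem heckeOpC_mem_hodge_F_one (hU : BallQuotientUniformisedDatum) (hA : Arapura2012_Cor_15_4_6) (hHD : exists_isReal_hodgeModel)
    (hI : hodgePQ_independent_of_hodgeModel) (hg : g ∈ unitaryGroup (conjRingHom D.E) D.H) {n : ℕ} (hX : IsSmoothProjective n X)
    {ω : ℂ ⊗[ℚ] bettiCohomology X 1} (hω : ω ∈ (BettiUniverse.hodge hHD hX 1).F 1) :
    heckeOpC D hX 1 g ω ∈ (BettiUniverse.hodge hHD hX 1).F 1 := by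
  obtain ⟨XN', DN', hH', hΓ', π, hπ, πq, hπq⟩ := exists_heckeLevelModel D hU hA hHD hg
  exact HeckeHodgeType.heckeOpC_mem_hodge_F_one (isHeckeAdmissible D hU hg) DN' hH' hΓ' hHD hI hX π hπ πq hπq hω

/-- **(J2) over the records: `classLift 𝔣 (T_g ω) = [Γ ∩ g⁻¹Γg : N_g]⁻¹ • Σ_{q ∈ Γ/N_g} h_q^* (classLift 𝔣 ω)`**, `h_q = frameIso 𝔣 ((g γ̃_q)^{τ₁})`, for every compact
ball quotient surface datum `D`, frame `𝔣`, `g ∈ U(V)(F)` and `ω ∈ F¹H¹(X)`. [cite: Shimura1973, §8.3] [cite: Borel1997, §5.13–5.14] -/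
theorem classLift_heckeOpC (hU : BallQuotientUniformisedDatum) (hA : Arapura2012_Cor_15_4_6) (hHD : exists_isReal_hodgeModel)
    (hI : hodgePQ_independent_of_hodgeModel) (𝔣 : D.SylvesterFrame) (hg : g ∈ unitaryGroup (conjRingHom D.E) D.H)
    {ω : ℂ ⊗[ℚ] bettiCohomology X 1} (hω : ω ∈ (BettiUniverse.hodge hHD D.isSmoothProjective 1).F 1) :
    letI : (D.heckeLevel g).FiniteIndex := (isHeckeAdmissible D hU hg).finiteIndex
    letI : Fintype (↥D.Γ ⧸ D.heckeLevel g) := Subgroup.fintypeQuotientOfFiniteIndex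
    D.classLift hHD 𝔣 (heckeOpC D D.isSmoothProjective 1 g ω) =
      ((D.heckeIndex g : ℂ)⁻¹) • ∑ q : ↥D.Γ ⧸ D.heckeLevel g,
        BallForms.factorPullback BallForms.cotangentCocycle (D.frameIso 𝔣 (cosetRealPoint (isHeckeAdmissible D hU hg) (Quotient.out q)))
          (D.classLift hHD 𝔣 ω) := by
  obtain ⟨XN', DN', hH', hΓ', π, hπ, πq, hπq⟩ := exists_heckeLevelModel D hU hA hHD hg
  exact HeckeClassLift.classLift_heckeOpC (isHeckeAdmissible D hU hg) DN' hH' hΓ' hHD hI 𝔣 π hπ πq hπq hω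

end HodgeCM.Model.HeckeClassLiftRecords

end
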